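import Mathlib.Analysis.InnerProductSpace.PiL2
import Mathlib.Topology.Order.Basic
import Literature.Analysis.FluidPDE.MildSolutions
import Literature.Analysis.FluidPDE.CriticalSpaces
import HarnessLib

/-!
# Named fact: compactness modulo symmetries of the set of `Ḣ^{1/2}`-minimal blow-up data
(Rusin–Šverák 2011)

Grounder file (D-0014 named facts) for the route `NavierStokesRegularity/MinimalBlowupRigidity`
(regrounding of statement item stmt-NavierStokesRegularity-0109,
`Summit.NavierStokesRegularity.NavierStokesRegularity.Theses.MinimalBlowupRigidity`, crux #5
"critical element"). Companion of `Literature.Analysis.FluidPDE.rusin_sverak_minimal_blowup`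
(`Literature/Analysis/FluidPDE/MildSolutions.lean`), which records the *first* clause of the
corollary below (non-emptiness of `M`); this file records the *second* clause (compactness of `M`
modulo scalings and translations), which the route's crux #5 should use in place of an
orbit-compactness statement (see the reground note on item 0109: by Kenig–Koch 2011, Thm. 1, a
blow-up mild solution is unbounded in `Ḣ^{1/2}`, so its orbit is never precompact modulo the
`Ḣ^{1/2}`-isometric symmetries).

In print (Rusin–Šverák, arXiv:0911.0500, p. 8, Corollary 4.3 = J. Funct. Anal. 260 (2011)
879–891; normalisation `ν = 1`): with `ρ_max = sup {ρ ; T_max(u₀) = +∞ for all u₀ ∈ B_ρ}` and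
`M = {u₀ ∈ Ḣ^{1/2} ; T_max(u₀) < ∞, ‖u₀‖_{Ḣ^{1/2}} = ρ_max}`:
"The set `M` is non-empty. Moreover, `M` is compact modulo scalings and translations, i.e. if
`u₀^k ∈ M` is a sequence in `M`, then there exist `λ_k > 0` and `x₀^k ∈ ℝ³` such the sequence
`v^k ∈ Ḣ^{1/2}` defined by `v^k(x) = λ_k u₀^k(λ_k x - x₀^k)` is compact in `Ḣ^{1/2}`."
(Second printed source: Gallagher–Koch–Planchon, Math. Ann. 355 (2013), arXiv:1012.0145 p. 18,
Statement 4.1 + Thm. 9 with `X = Y = Ḣ^{d/2-1}(ℝ^d)`.)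

Transcription (same conventions as `rusin_sverak_minimal_blowup`): a datum is an `L³` field
`u₀ : ℝ³ → ℝ³` represented by `g ∈ HomSobolev ℝ³ ℂ³ (1/2)` (`HomSobolev.Represents`); membership
in `M` is `‖g‖ₑ = rusinSverakRhoMaxPure ν ∧ ¬ HasGlobalKatoSolution ν u₀` ("`T_max < ∞`" ↔ no
global `C_t L³` mild solution, Kato = Fujita–Kato solutions for `Ḣ^{1/2}` data, as in the
docstring of `HasGlobalKatoSolution`); the modulated datum is
`NS.rescaleData λ_k (u₀^k (· - x₀^k)) = λ_k u₀^k (λ_k · - x₀^k)`; "the sequence is compact in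
`Ḣ^{1/2}`" is `IsCompact (closure (range g'))` for `Ḣ^{1/2}`-classes `g'_k` representing the
modulated data. General `ν > 0` from `ν = 1` by the viscosity scaling
(`rusinSverakRhoMaxPure_eq_mul`). The hypothesis `ρ_max < ∞` of the paper's standing assumption is
implied by `M ≠ ∅` and is kept explicit.

Nothing is asserted; users take `(h : Literature.NS.rusin_sverak_minimal_data_compact)`.

## References

* W. Rusin, V. Šverák, *Minimal initial data for potential Navier–Stokes singularities*,
  J. Funct. Anal. 260 (2011) 879–891; arXiv:0911.0500, Cor. 4.3 (p. 8), Thm. 4.2 (p. 7).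
* I. Gallagher, G. S. Koch, F. Planchon, Math. Ann. 355 (2013) 1527–1559; arXiv:1012.0145,
  Statement 4.1 and Thm. 9 (p. 18).
* C. E. Kenig, G. S. Koch, Ann. IHP (C) 28 (2011) 159–187; arXiv:0908.3349, Thm. 1 (p. 3).
-/

noncomputable section

open MeasureTheory Set Function Filter Topology
open scoped ENNReal

namespace Literature.Analysis.FluidPDE

local notation "ℝ³" => EuclideanSpace ℝ (Fin 3)
local notation "ℂ³" => EuclideanSpace ℂ (Fin 3)

/-- Membership in Rusin–Šverák's set `M` of `Ḣ^{1/2}`-minimal singularity-generating data, for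
viscosity `ν`: `u₀ ∈ L³` is weakly divergence free, represented by `g ∈ Ḣ^{1/2}` with
`‖g‖_{Ḣ^{1/2}} = ρ_max^pure(ν)`, and has no global Kato solution (`T_max(u₀) < ∞`).
This is exactly the conjunction produced by `rusin_sverak_minimal_blowup`.
[cite: RusinSverak2011, Cor. 4.3 (arXiv:0911.0500 p. 8, definition of M)] -/
def IsMinimalBlowupDatum (ν : ℝ) (u₀ : ℝ³ → ℝ³) (g : FunctionSpaces.HomSobolev ℝ³ ℂ³ (1 / 2 : ℝ)) : Prop :=
  MemLp u₀ 3 ∧ g.Represents (FunctionSpaces.EuclideanSpace.complexify ∘ u₀) ∧ FluidPDE.IsWeaklyDivFree u₀ ∧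
    ‖g‖ₑ = rusinSverakRhoMaxPure ν ∧ ¬ HasGlobalKatoSolution ν u₀

/-- NAMED FACT (Rusin–Šverák, J. Funct. Anal. 260 (2011), arXiv:0911.0500 Cor. 4.3, second
clause; also Gallagher–Koch–Planchon, Math. Ann. 355 (2013), Thm. 9 for `X = Y = Ḣ^{1/2}`).
Let `ν > 0` with `ρ_max^pure(ν) < ∞`. If `(u₀^k, g_k)_k` is a sequence of `Ḣ^{1/2}`-minimal
blow-up data (`IsMinimalBlowupDatum ν`), then there are scales `λ_k > 0`, centres `x₀^k ∈ ℝ³` and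
classes `g'_k ∈ Ḣ^{1/2}` representing the modulated data `x ↦ λ_k u₀^k(λ_k x - x₀^k)`
(`NS.rescaleData λ_k (u₀^k (· - x₀^k))`) such that `{g'_k}` has compact closure in `Ḣ^{1/2}`
("the sequence `v^k` is compact in `Ḣ^{1/2}`"). Grounds (as replacement statement) crux #5 of
`Summit.NavierStokesRegularity.NavierStokesRegularity.Theses.MinimalBlowupRigidity`
(item stmt-NavierStokesRegularity-0109). Users take `(h : rusin_sverak_minimal_data_compact)`.
[cite: RusinSverak2011, Cor. 4.3 (arXiv:0911.0500 p. 8)] -/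
def rusin_sverak_minimal_data_compact : Prop :=
  ∀ (ν : ℝ) (_hν : 0 < ν) (_hfin : rusinSverakRhoMaxPure ν < ∞)
    (u₀ : ℕ → ℝ³ → ℝ³) (g : ℕ → FunctionSpaces.HomSobolev ℝ³ ℂ³ (1 / 2 : ℝ)),
    (∀ k, IsMinimalBlowupDatum ν (u₀ k) (g k)) →
    ∃ (lam : ℕ → ℝ) (x₀ : ℕ → ℝ³) (g' : ℕ → FunctionSpaces.HomSobolev ℝ³ ℂ³ (1 / 2 : ℝ)),
      (∀ k, 0 < lam k) ∧
      (∀ k, (g' k).Represents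
        (FunctionSpaces.EuclideanSpace.complexify ∘ FluidPDE.rescaleData (lam k) (fun x => u₀ k (x - x₀ k)))) ∧
      IsCompact (closure (Set.range g'))

/-- Sanity: the datum produced by `rusin_sverak_minimal_blowup` is a minimal blow-up datum in the
sense of `IsMinimalBlowupDatum` (definitional repackaging). [folklore] -/
theorem exists_isMinimalBlowupDatum (h : rusin_sverak_minimal_blowup) {ν : ℝ} (hν : 0 < ν)
    (hfin : rusinSverakRhoMaxPure ν < ∞) :
    ∃ (u₀ : ℝ³ → ℝ³) (g : FunctionSpaces.HomSobolev ℝ³ ℂ³ (1 / 2 : ℝ)), IsMinimalBlowupDatum ν u₀ g := by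
  obtain ⟨u₀, g, h1, h2, h3, h4, h5⟩ := h ν hν hfin
  exact ⟨u₀, g, h1, h2, h3, h4, h5⟩

end Literature.Analysis.FluidPDE

end
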